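import Literature.MathematicalPhysics.QuantumFieldTheory.GawedzkiKupiainen1985.PeriodicGleason
import Literature.MathematicalPhysics.QuantumFieldTheory.Balaban1983to89.B12Sec2to5

/-!
# `Balaban1983to89.B12Rep537` — [Balaban1987RG1] §5 p. 297: the representation (5.37)/(5.38) of the vacuum
polarization tensor, the forced value (5.42) of `β`, and the decay (5.44) of the third-order remainder — typed on
the COEFFICIENT (position-space) side and proved from (5.10) + the second-order Taylor data (5.36), the "Laurent
method of [43]" step being the kernel theorem `GawedzkiKupiainen1985.PeriodicGleason.gleason_coeff` (k = 3)

CITATION HEADER (lean-in-tree rule 2026-08-18).  Source: T. Bałaban, *Renormalization group approach to lattice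
gauge field theories. I. Generation of effective actions in a small field approximation and a coupling constant
renormalization in four dimensions*, Commun. Math. Phys. **109**, 249–301 (1987), doi:10.1007/bf01215223
[Balaban1987RG1] (held: `paper:balaban1987-cmp109-rg-i-small-field`; journal page = PDF page + 248).  The displays
quoted below were READ FROM THE 300-dpi PAGE RENDERS of p. 293 [PDF 45] and p. 297 [PDF 49]
(`HOME/b2b-balaban-ref1/pages/1987-cmp109-rg-I-small-field/…-p045-x2.png`, `…-p049-x2.png`), and agree with the
audited lineage transcript `HOME/b2b-balaban-b03/B12s-transcript.md` (b03 gen 1; census `HOME/GAPS.md` C-B12s-*).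
Method source: K. Gawędzki, A. Kupiainen, Commun. Math. Phys. **99** (1985) 197–252, Appendix 2, Lemma p. 248
[GawedzkiKupiainenMasslessLattice1985] = B12's reference [43], kernel-reproduced in
`…GawedzkiKupiainen1985.PeriodicGleason` (imported).  Audit cell `pub-balaban`, unit `b2b-balaban-b03-g6`
(B12 §§2–5 lineage), node B12-REP537-COEFF.  Value = typed statement + kernel certificate of a printed derivation
step, NOT summit progress; nothing is asserted about the sign or size of Bałaban's β (cell GAPS G-B12s-*, G-adv2-3).

THE PRINTED TEXT (verbatim).  NOTATION (v1.1, DOCFIX G-ref5-91 class, self-applied): the print writes Π_{μν}(p), Π_{μν}(ζ), Π′_{μν}(p) WITHOUT a tilde for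
the momentum-space function of (5.11) (renders p045/p049/p050 re-read as images); inside quotation marks this header now
follows the print exactly; OUTSIDE quotation marks Π̃, Π̃′ (tilde ours) denote the momentum-space functions, to keep them
apart from the position-space kernel Π_{μν}(x).  v1 → v1.1: docstrings only; every Lean declaration byte-unchanged.
* (5.10) p. 293: "The representation (4.37) yields the following inequality |Π_{μν}(x − y)| ≤ O(1)E₀ exp(−δ₁|x − y|),
  (5.10) with a positive constant δ₁ determined by δ₀, κ, and M (e.g., δ₁ = 1/2min{δ₀, κM⁻¹}). Take the momentum
  representation of this tensor" (5.11) "Π_{μν}(p) = Σ_{x∈Z⁴} e^{−ip·x}Π_{μν}(x), Π_{μν}(x) = (2π)⁻⁴∫dp e^{ix·p}Π_{μν}(p),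
  … By the inequality (5.10) it can be extended as an analytic function to complex variables ζ_μ = p_μ + iq_μ,
  |q_μ| < δ₁."; (5.15) "Σ_μ ∂_μ(−ζ)Π_{μν}(ζ) = Σ_ν ∂_ν(ζ)Π_{μν}(ζ) = 0, where ∂_μ(ζ) = e^{iζ_μ} − 1."; (5.16) "We will
  analyze this function using the above properties only. Our goal is to prove a representation of the form (4.41),
  more exactly of the form Π_{μν}(p) = β(δ_{μν}Δ(p) − \overline{∂_μ(p)}∂_ν(p)) + (terms of higher orders in derivatives
  ∂(p), \overline{∂(p)}), (5.16) and to find the coefficient β."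
* p. 294: "We obtain such a representation using some simple expansion connected with the Laurent series expansion.
  It was used already in [43] for a similar purpose." ([43] = Gawędzki–Kupiainen, CMP 99.)
* (5.36) p. 297: "f_{μν}(z) = β(δ_{μν}Σ_κ(z_κ⁻¹ − 1)(z_κ − 1) − (z_μ⁻¹ − 1)(z_ν − 1)) + … . This is the desired
  representation of the functions f_{μν}(z). Using the relations (5.17) and substituting z_μ = e^{ip_μ}, we obtain
  finally" (5.37) "Π_{μν}(p) = β(δ_{μν}Δ(p) − \overline{∂_μ(p)}∂_ν(p)) + Π′_{μν}(p). The function Π′_{μν}(p) has all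
  the symmetries of the function Π_{μν}(p) and it can be written in the form of a third order polynomial in the
  derivatives \overline{∂(p)}, ∂(p)," (5.38) "Π′_{μν}(p) = Σ_{κ,λ,ρ}[Π′_{μν,κλρ}(p)\overline{∂_κ(p)}\,\overline{∂_λ(p)}
  \,\overline{∂_ρ(p)} + Π′_{μν,κ,λρ}(p)∂_κ(p)\overline{∂_λ(p)}\,\overline{∂_ρ(p)} + …]. The coefficients Π′ can be
  extended to analytic functions of ζ = p + iq on the polystrip ×_μ{|q_μ| < δ₁}."
* (5.42) p. 297: "β = −(∂²/∂p₁∂p₂ Π₁₂)(0) = −(∂²/∂p_μ∂p_ν Π_{μν})(0) = Σ_x Π_{μν}(x)x_μx_ν for μ ≠ ν. This is the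
  fundamental equality defining the β-function."
* (5.44) p. 297: "The analyticity properties mentioned after (5.38) imply the corresponding exponential decay
  properties of the functions in the above formula. More exactly, we have |Π′_{μν,κλρ}(x − y)| ≤ O(1)E₀
  exp(½δ₁|x − y|)." (sic; the minus sign is missing in print — transcript note M-5.44; meant: exp(−½δ₁|x − y|)).

THE DICTIONARY (coefficient side ↔ symbol side; B12's convention (5.11) Π̃(p) = Σ_x e^{−ip·x}Π(x)).  With
`w_j = e^{−iζ_j}` the symbol is the generating function `PeriodicGleason.genFun Π w = Σ_x Π(x) wˣ`; multiplication of
the symbol by `\overline{∂_μ(p)} = ∂_μ(−ζ) = e^{−iζ_μ} − 1 = w_μ − 1` is the BACKWARD difference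
`PeriodicGleason.delta μ : Π ↦ Π(· − e_μ) − Π` (`genFun_delta`), by `∂_ν(ζ) = e^{iζ_ν} − 1 = w_ν⁻¹ − 1` the FORWARD
difference `fdelta ν : Π ↦ Π(· + e_ν) − Π` (`genFun_fdelta`), and the constant symbol `1` is the Kronecker kernel
`dirac`.  Reading (5.36) ↦ (5.37) literally ("substituting z_μ = e^{ip_μ}", so (z_κ⁻¹ − 1)(z_κ − 1) ↦
\overline{∂_κ}∂_κ): `Δ(p) = Σ_κ \overline{∂_κ(p)}∂_κ(p)` and the position kernel of `δ_{μν}Δ(p) − \overline{∂_μ(p)}∂_ν(p)`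
is `wilsonQ μ ν = δ_{μν}Σ_κ Δ*_κΔ_κδ₀ − Δ*_μΔ_νδ₀` (`genFun_wilsonQ` certifies the symbol).  The Taylor coefficients of
the symbol at `p = 0` are the monomial moments: `∂^γ_p Π̃(0) = (−i)^{|γ|}Σ_x Π(x)x^γ` (differentiation under the
absolutely convergent sum (5.10) — the one standard passage NOT formalised here, exactly as in `PeriodicGleason`);
accordingly "(5.36)/(5.37) hold up to third-order terms" is typed as `TaylorData3 β μ ν Π`: every monomial moment of
order ≤ 2 of `Π` equals `β ×` that of `wilsonQ μ ν` (`tsum_wilsonQ`, `tsum_wilsonQ_mul_coord`,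
`tsum_wilsonQ_mul_coord2` evaluate the latter: 0, 0, and `−∂_κ∂_λ[δ_{μν}|p|² − p_μp_ν]`).

WHAT IS PROVED (every `theorem` kernel-checked; `d` arbitrary; constants explicit).
* `wilsonQ_bound`: the marginal kernel is exponentially bounded at every rate (finite support), constant
  `MQ a d = (d + 1)(e^a + 1)²`; `genFun_wilsonQ`: its symbol is `δ_{μν}Σ_κ(w_κ − 1)(w_κ⁻¹ − 1) − (w_μ − 1)(w_ν⁻¹ − 1)` —
  (5.36)/(5.37)'s quadratic form, verbatim shape.
* `hasSum_wilsonQ_mul` and the three moment evaluations above (the second-order Taylor data of β(δ_{μν}Δ − \overline{∂_μ}∂_ν)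
  ARE those of β(δ_{μν}|p|² − p_μp_ν)).
* `beta_eq_542` — (5.42) IS FORCED: `TaylorData3 β μ ν Π ∧ μ ≠ ν ⇒ β = Σ_x Π(x)x_μx_ν`; for a real B12 kernel this is
  `B12Beta.secondMoment` = the right member of (1.22) (`beta_eq_secondMoment`).
* `momentsVanish_sub`: (5.10)-type decay + `TaylorData3` ⇒ `PeriodicGleason.MomentsVanish 3 (Π − β•wilsonQ μ ν)`.
* `rep538` — (5.37)+(5.38)+(5.44), coefficient form: `Π(x) − β·wilsonQ μ ν x = Σ_{(κ,λ,ρ)} (Δ*_κΔ*_λΔ*_ρ Π′_{κλρ})(x)`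
  with `|Π′_{κλρ}(x)| ≤ K(δ₁,d)³·(M + |β|·MQ(δ₁,d))·e^{−δ₁|x|₁}` — the remainder is a third-order polynomial in the
  backward differences (only the first monomial type `\overline{∂}\overline{∂}\overline{∂}` of (5.38) is needed), the
  coefficient kernels decay at the FULL rate δ₁ in the ℓ¹ distance (print: ½δ₁; since |x|_∞ ≤ |x|₂ ≤ |x|₁ the bound
  implies decay at rate δ₁ in any of these distances), with "O(1)" = `K(δ₁,d)³` of `PeriodicGleason` (depends on δ₁
  and d only) times `M + |β|·MQ` (and |β| ≤ M·C(δ₁,d) by (5.42), cf. `B12Sec2to5.secondMoment_abs_le_of_decay510`).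
* `rep537_genFun` — the printed multiplicative form on the closed poly-annulus `e^{−b} ≤ |w_j| ≤ e^{b}`, `b < δ₁`
  (= the closed sub-polystrip |q_j| ≤ b): `Π̃ = β(δ_{μν}Σ_κ(w_κ − 1)(w_κ⁻¹ − 1) − (w_μ − 1)(w_ν⁻¹ − 1))
  + Σ_{(κ,λ,ρ)}(w_κ − 1)(w_λ − 1)(w_ρ − 1)·Π̃′_{κλρ}(w)` with `|Π̃′_{κλρ}(w)| ≤ K³(M + |β|MQ)·Z_d(δ₁ − b)` — i.e. (5.37) with
  (5.38) and "the coefficients Π′ can be extended to analytic functions … on the polystrip" in the form of absolutely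
  convergent Laurent series with sup bounds on every closed sub-polystrip.
* `expBound_of_decay510`, `rep538_of_decay510`: the same from the cell's typed (5.10) `B12Sec2to5.Decay510`.

WHAT IS NOT PROVED HERE (displayed hypotheses, as in print's own logic).  (i) The DERIVATION of the second-order
Taylor data (5.36) from the symmetries (5.12)–(5.15) via the Laurent splitting (5.17)–(5.35): its finite algebra is
kernel-checked at jet level in `…Balaban1983to89.B12Sec5Algebra` (b12-g2: `transverse_jet`, `eq536_11/_12`, with the
one located harmless slip G-b12g2-1), and is NOT re-derived on the coefficient side — it enters as the hypothesis
`TaylorData3`.  (ii) The identification of Taylor coefficients of Π̃ at 0 with monomial moments (standard, see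
above).  (iii) (5.10) itself (INPUT of §5; `B12Decay510*` modules).  (iv) The use (5.43) of the representation.
NOTHING of the series is asserted: every hypothesis is displayed, every `def` is a concrete object.
-/

namespace Literature.MathematicalPhysics.QuantumFieldTheory.Balaban1983to89.B12Rep537

noncomputable section

open Literature.MathematicalPhysics.QuantumFieldTheory.GawedzkiKupiainen1985.PeriodicGleason

variable {d : ℕ}

/-! ## §1 The position-space dictionary for `∂(p)`, `\overline{∂(p)}`, `1` and the marginal kernel -/

/-- The FORWARD lattice difference `(Δ_ν g)(x) = g(x + e_ν) − g(x)`: multiplication of the symbol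
`Σ_x g(x)e^{−ip·x}` by `∂_ν(p) = e^{ip_ν} − 1` (`genFun_fdelta`: by `w_ν⁻¹ − 1` at `w = e^{−ip}`).
[cite: Balaban1987RG1, (5.15) p.293 (∂_μ(ζ) = e^{iζ_μ} − 1) / (5.9) p.293 (∂_ν)] -/
def fdelta (ν : Fin d) (g : Pt d → ℂ) (x : Pt d) : ℂ := g (x + unitVec ν) - g x

/-- The Kronecker kernel `δ₀` (symbol `≡ 1`). [folklore] -/
def dirac (x : Pt d) : ℂ := if x = 0 then 1 else 0

/-- The position kernel of `\overline{∂_μ(p)}∂_ν(p)`: `Δ*_μ Δ_ν δ₀` (backward after forward difference of `δ₀`); for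
`μ = ν` it is the kernel of `|∂_μ(p)|² = (z_μ⁻¹ − 1)(z_μ − 1)`. [cite: Balaban1987RG1, (5.36)–(5.37) p.297] -/
def crossQ (μ ν : Fin d) : Pt d → ℂ := delta μ (fdelta ν dirac)

/-- **The marginal kernel of (5.36)/(5.37)**: the position kernel `Q_{μν}` of
`δ_{μν}Δ(p) − \overline{∂_μ(p)}∂_ν(p)`, `Δ(p) = Σ_κ \overline{∂_κ(p)}∂_κ(p)` — the quadratic form of the linearised
Wilson action ("coupling constant renormalization only"). [cite: Balaban1987RG1, (5.36)–(5.37) p.297; (5.16) p.293] -/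
def wilsonQ (μ ν : Fin d) (x : Pt d) : ℂ := (if μ = ν then ∑ κ, crossQ κ κ x else 0) - crossQ μ ν x

/-- Kronecker delta on indices (the `δ_{μν}` of (5.16)/(5.37)). [folklore] -/
def kron (i j : Fin d) : ℂ := if i = j then 1 else 0

/-- `δ` is symmetric. [folklore] -/
theorem kron_comm (i j : Fin d) : kron i j = kron j i := by
  unfold kron; split_ifs <;> simp_all

/-- Components of the unit vectors are Kronecker deltas. [folklore] -/
@[simp] theorem unitVec_cast (i j : Fin d) : (((unitVec i) j : ℤ) : ℂ) = kron j i := by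
  unfold unitVec kron; split_ifs <;> simp

/-- `|x + e_ν|₁ ≥ |x|₁ − 1` (`|−x|₁ = |x|₁` is `B12Decay510Window.l1_neg`; inlined to keep the imports light). [folklore] -/
theorem l1_add_unitVec_ge (n : Pt d) (ν : Fin d) : l1 n - 1 ≤ l1 (n + unitVec ν) := by
  have hneg : ∀ m : Pt d, l1 (-m) = l1 m := fun m => by simp [l1]
  have h := l1_sub_unitVec_ge (-n) ν
  have e : -n - unitVec ν = -(n + unitVec ν) := by abel
  rwa [e, hneg, hneg] at h

/-! ## §2 Exponential bounds (the marginal kernel is finitely supported) -/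

/-- The forward difference preserves the decay rate (constant `× (e^a + 1)`). [folklore] -/
theorem fdelta_bound {a M : ℝ} (ha : 0 < a) {g : Pt d → ℂ} (hg : ExpBound a M g) (ν : Fin d) :
    ExpBound a (M * (Real.exp a + 1)) (fdelta ν g) := by
  intro n
  have h1 : wt a (n + unitVec ν) ≤ Real.exp a * wt a n := by
    rw [wt, wt, ← Real.exp_add]
    exact Real.exp_le_exp.mpr (by nlinarith [l1_add_unitVec_ge n ν, ha.le])
  calc ‖fdelta ν g n‖ ≤ ‖g (n + unitVec ν)‖ + ‖g n‖ := norm_sub_le _ _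
    _ ≤ M * wt a (n + unitVec ν) + M * wt a n := add_le_add (hg _) (hg _)
    _ ≤ M * (Real.exp a * wt a n) + M * wt a n := by gcongr; exact hg.nonneg
    _ = M * (Real.exp a + 1) * wt a n := by ring

/-- `δ₀` is exponentially bounded at every rate, constant 1. [folklore] -/
theorem expBound_dirac (a : ℝ) : ExpBound a 1 (dirac : Pt d → ℂ) := by
  intro n
  unfold dirac
  split_ifs with h
  · subst h; simp [wt, l1]
  · simpa using (wt_pos a n).le

/-- `Δ*_μΔ_νδ₀` is exponentially bounded at every rate, constant `(e^a + 1)²`. [folklore] -/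
theorem crossQ_bound {a : ℝ} (ha : 0 < a) (μ ν : Fin d) :
    ExpBound a ((Real.exp a + 1) ^ 2) (crossQ μ ν : Pt d → ℂ) := by
  have h := delta_bound ha (fdelta_bound ha (expBound_dirac (d := d) a) ν) μ
  exact h.mono (le_of_eq (by ring))

/-- The explicit constant `MQ(a,d) = (d + 1)(e^a + 1)²` bounding the marginal kernel at rate `a`. [folklore] -/
def MQ (a : ℝ) (d : ℕ) : ℝ := (d + 1) * (Real.exp a + 1) ^ 2

/-- `MQ ≥ 0`. [folklore] -/
theorem MQ_nonneg (a : ℝ) (d : ℕ) : 0 ≤ MQ a d := by unfold MQ; positivity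

/-- **The marginal kernel is exponentially bounded at every rate `a > 0`** (it is finitely supported):
`|Q_{μν}(x)| ≤ MQ(a,d)·e^{−a|x|₁}`. [cite: Balaban1987RG1, (5.36)–(5.37) p.297] -/
theorem wilsonQ_bound {a : ℝ} (ha : 0 < a) (μ ν : Fin d) : ExpBound a (MQ a d) (wilsonQ μ ν : Pt d → ℂ) := by
  intro x
  have hC : 0 ≤ (Real.exp a + 1) ^ 2 * wt a x := by have := wt_pos a x; positivity
  have hcross : ‖crossQ μ ν x‖ ≤ (Real.exp a + 1) ^ 2 * wt a x := crossQ_bound ha μ ν x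
  have hlap : ‖(if μ = ν then ∑ κ, crossQ κ κ x else 0 : ℂ)‖ ≤ d * ((Real.exp a + 1) ^ 2 * wt a x) := by
    split_ifs
    · calc ‖∑ κ, crossQ κ κ x‖ ≤ ∑ κ, ‖crossQ κ κ x‖ := norm_sum_le _ _
        _ ≤ ∑ κ : Fin d, (Real.exp a + 1) ^ 2 * wt a x :=
          Finset.sum_le_sum fun κ _ => crossQ_bound ha κ κ x
        _ = d * ((Real.exp a + 1) ^ 2 * wt a x) := by simp
    · rw [norm_zero]; positivity
  calc ‖wilsonQ μ ν x‖ ≤ ‖(if μ = ν then ∑ κ, crossQ κ κ x else 0 : ℂ)‖ + ‖crossQ μ ν x‖ := norm_sub_le _ _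
    _ ≤ d * ((Real.exp a + 1) ^ 2 * wt a x) + (Real.exp a + 1) ^ 2 * wt a x := add_le_add hlap hcross
    _ = MQ a d * wt a x := by unfold MQ; ring

/-- `Π − β·Q` is exponentially bounded with constant `M + |β|·MQ`. [folklore] -/
theorem expBound_sub {a M : ℝ} (ha : 0 < a) {P : Pt d → ℂ} (hP : ExpBound a M P) (β : ℂ) (μ ν : Fin d) :
    ExpBound a (M + ‖β‖ * MQ a d) (P - β • wilsonQ μ ν) := by
  have h := hP.add ((wilsonQ_bound ha μ ν).smul (-β))
  rw [norm_neg] at h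
  have e : P - β • wilsonQ μ ν = P + -β • wilsonQ μ ν := by rw [neg_smul, sub_eq_add_neg]
  rw [e]; exact h

/-! ## §3 The symbol of the marginal kernel (generating functions on the poly-annulus) -/

/-- `z^(m − e_ν) = z^m · z_ν⁻¹` on the poly-annulus. [folklore] -/
theorem zpowv_add_neg_unitVec {b : ℝ} {z : Fin d → ℂ} (hz : z ∈ PolyAnnulus d b) (m : Pt d) (ν : Fin d) :
    zpowv z (m + -unitVec ν) = zpowv z m * (z ν)⁻¹ := by
  have h := zpowv_add_unitVec hz (m + -unitVec ν) ν
  rw [neg_add_cancel_right] at h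
  rw [h, mul_assoc, mul_inv_cancel₀ (ne_zero_of_mem hz ν), mul_one]

/-- The forward difference `Δ_ν` is multiplication by `w_ν⁻¹ − 1` (`= ∂_ν(ζ) = e^{iζ_ν} − 1` at `w = e^{−iζ}`) on
generating functions. [cite: Balaban1987RG1, (5.15) p.293 (∂_ν(ζ) = e^{iζ_ν} − 1); (5.17) p.294] -/
theorem genFun_fdelta {a M : ℝ} {g : Pt d → ℂ} (hg : ExpBound a M g) {b : ℝ} (hab : b < a)
    {z : Fin d → ℂ} (hz : z ∈ PolyAnnulus d b) (ν : Fin d) :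
    genFun (fdelta ν g) z = ((z ν)⁻¹ - 1) * genFun g z := by
  have hs : Summable fun n => g n * zpowv z n := hg.summable_mul_zpowv hab hz
  have hshift : ∑' n, g (n + unitVec ν) * zpowv z n = (z ν)⁻¹ * genFun g z := by
    rw [← (Equiv.addRight (-unitVec ν)).tsum_eq]
    simp only [Equiv.coe_addRight, neg_add_cancel_right, zpowv_add_neg_unitVec hz, genFun, ← tsum_mul_left]
    exact tsum_congr fun n => by ring
  have hs' : Summable fun n => g (n + unitVec ν) * zpowv z n := by
    rw [← (Equiv.addRight (-unitVec ν)).summable_iff]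
    refine (hs.mul_right ((z ν)⁻¹)).congr fun n => ?_
    simp [zpowv_add_neg_unitVec hz]; ring
  unfold genFun
  simp only [fdelta, sub_mul]
  rw [hs'.tsum_sub hs, hshift, genFun]; ring

/-- The symbol of `δ₀` is `1`. [folklore] -/
theorem genFun_dirac (z : Fin d → ℂ) : genFun dirac z = 1 := by
  unfold genFun
  rw [tsum_eq_single 0]
  · simp [dirac, zpowv]
  · intro n hn; simp [dirac, hn]

/-- The symbol of `Δ*_μΔ_νδ₀` is `(w_μ − 1)(w_ν⁻¹ − 1)` (`= \overline{∂_μ(p)}∂_ν(p)` at `w = e^{−ip}`).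
[cite: Balaban1987RG1, (5.36)–(5.37) p.297] -/
theorem genFun_crossQ {b : ℝ} {z : Fin d → ℂ} (hz : z ∈ PolyAnnulus d b) (μ ν : Fin d) :
    genFun (crossQ μ ν) z = (z μ - 1) * ((z ν)⁻¹ - 1) := by
  have ha : 0 < |b| + 1 := by positivity
  have hab : b < |b| + 1 := by linarith [le_abs_self b]
  have h0 : ExpBound (|b| + 1) 1 (dirac : Pt d → ℂ) := expBound_dirac _
  have h1 := fdelta_bound ha h0 ν
  unfold crossQ
  rw [genFun_delta h1 hab hz μ, genFun_fdelta h0 hab hz ν, genFun_dirac]; ring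

/-- Linearity of generating functions (difference), under summability. [folklore] -/
theorem genFun_sub_of_summable {f g : Pt d → ℂ} {z : Fin d → ℂ} (hf : Summable fun n => f n * zpowv z n)
    (hg : Summable fun n => g n * zpowv z n) :
    genFun (fun x => f x - g x) z = genFun f z - genFun g z := by
  unfold genFun; rw [← hf.tsum_sub hg]; exact tsum_congr fun n => by rw [sub_mul]

/-- Linearity of generating functions (finite sums), under summability. [folklore] -/
theorem genFun_sum_of_summable {ι : Type*} (s : Finset ι) {f : ι → Pt d → ℂ} {z : Fin d → ℂ}
    (hf : ∀ i ∈ s, Summable fun n => f i n * zpowv z n) :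
    genFun (fun x => ∑ i ∈ s, f i x) z = ∑ i ∈ s, genFun (f i) z := by
  unfold genFun; rw [← Summable.tsum_finsetSum hf]; exact tsum_congr fun n => by rw [Finset.sum_mul]

/-- **The symbol of the marginal kernel is the quadratic form of (5.36)/(5.37)**:
`Σ_x Q_{μν}(x)wˣ = δ_{μν}Σ_κ(w_κ − 1)(w_κ⁻¹ − 1) − (w_μ − 1)(w_ν⁻¹ − 1)` on every poly-annulus (at `w = e^{−iζ}`:
`δ_{μν}Σ_κ ∂_κ(−ζ)∂_κ(ζ) − ∂_μ(−ζ)∂_ν(ζ) = δ_{μν}Δ − \overline{∂_μ}∂_ν`; at `w = z⁻¹`: the printed (5.36)).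
[cite: Balaban1987RG1, (5.36)–(5.37) p.297] -/
theorem genFun_wilsonQ {b : ℝ} {z : Fin d → ℂ} (hz : z ∈ PolyAnnulus d b) (μ ν : Fin d) :
    genFun (wilsonQ μ ν) z =
      (if μ = ν then ∑ κ, (z κ - 1) * ((z κ)⁻¹ - 1) else 0) - (z μ - 1) * ((z ν)⁻¹ - 1) := by
  have ha : 0 < |b| + 1 := by positivity
  have hab : b < |b| + 1 := by linarith [le_abs_self b]
  have hs : ∀ κ κ' : Fin d, Summable fun n => crossQ κ κ' n * zpowv z n :=
    fun κ κ' => (crossQ_bound ha κ κ').summable_mul_zpowv hab hz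
  have hfirst : genFun (fun x => (if μ = ν then ∑ κ, crossQ κ κ x else 0 : ℂ)) z =
      (if μ = ν then ∑ κ, (z κ - 1) * ((z κ)⁻¹ - 1) else 0) := by
    by_cases h : μ = ν
    · simp only [if_pos h]
      rw [genFun_sum_of_summable Finset.univ (fun κ _ => hs κ κ)]
      exact Finset.sum_congr rfl fun κ _ => genFun_crossQ hz κ κ
    · simp only [if_neg h]; unfold genFun; simp
  have hsf : Summable fun n => (if μ = ν then ∑ κ, crossQ κ κ n else 0 : ℂ) * zpowv z n := by
    by_cases h : μ = ν
    · simp only [if_pos h]; simp_rw [Finset.sum_mul]; exact summable_sum fun κ _ => hs κ κ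
    · simp only [if_neg h, zero_mul]; exact summable_zero
  have hw : (wilsonQ μ ν : Pt d → ℂ) = fun x => (if μ = ν then ∑ κ, crossQ κ κ x else 0 : ℂ) - crossQ μ ν x :=
    rfl
  rw [hw, genFun_sub_of_summable hsf (hs μ ν), hfirst, genFun_crossQ hz μ ν]

/-! ## §4 The Taylor data of the marginal kernel at `p = 0` (moments of order ≤ 2) -/

/-- `Σ_x δ₀(x + s)φ(x) = φ(−s)`. [folklore] -/
theorem hasSum_dirac_shift_mul (s : Pt d) (φ : Pt d → ℂ) :
    HasSum (fun x => dirac (x + s) * φ x) (φ (-s)) := by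
  have h : ∀ x, x ≠ -s → dirac (x + s) * φ x = 0 := by
    intro x hx
    have : x + s ≠ 0 := fun h' => hx (eq_neg_of_add_eq_zero_left h')
    simp [dirac, this]
  convert hasSum_single (-s) h using 1
  simp [dirac]

/-- Pointwise expansion `Δ*_μΔ_νδ₀(x) = δ₀(x − e_μ + e_ν) − δ₀(x − e_μ) − δ₀(x + e_ν) + δ₀(x)`. [folklore] -/
theorem crossQ_apply (μ ν : Fin d) (x : Pt d) :
    crossQ μ ν x = dirac (x + (unitVec ν - unitVec μ)) - dirac (x + -unitVec μ) - dirac (x + unitVec ν) +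
      dirac (x + 0) := by
  have e1 : x - unitVec μ + unitVec ν = x + (unitVec ν - unitVec μ) := by abel
  have e2 : x - unitVec μ = x + -unitVec μ := by abel
  simp only [crossQ, delta, fdelta]
  rw [e1, e2, add_zero]; ring

/-- Pairing of `Δ*_μΔ_νδ₀` with an arbitrary test function:
`Σ_x (Δ*_μΔ_νδ₀)(x)φ(x) = φ(e_μ − e_ν) − φ(e_μ) − φ(−e_ν) + φ(0)`. [folklore] -/
theorem hasSum_crossQ_mul (μ ν : Fin d) (φ : Pt d → ℂ) :
    HasSum (fun x => crossQ μ ν x * φ x)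
      (φ (unitVec μ - unitVec ν) - φ (unitVec μ) - φ (-unitVec ν) + φ 0) := by
  have h1 := hasSum_dirac_shift_mul (unitVec ν - unitVec μ) φ
  have h2 := hasSum_dirac_shift_mul (-unitVec μ) φ
  have h3 := hasSum_dirac_shift_mul (unitVec ν) φ
  have h4 := hasSum_dirac_shift_mul (0 : Pt d) φ
  have h := ((h1.sub h2).sub h3).add h4
  rw [neg_sub, neg_neg, neg_zero] at h
  have e : (fun x => crossQ μ ν x * φ x) = fun x =>
      dirac (x + (unitVec ν - unitVec μ)) * φ x - dirac (x + -unitVec μ) * φ x - dirac (x + unitVec ν) * φ x +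
        dirac (x + 0) * φ x := by
    funext x; rw [crossQ_apply]; ring
  rw [e]; exact h

/-- **Pairing of the marginal kernel with an arbitrary test function** (all its "moments"):
`Σ_x Q_{μν}(x)φ(x) = δ_{μν}Σ_κ(2φ(0) − φ(e_κ) − φ(−e_κ)) − (φ(e_μ − e_ν) − φ(e_μ) − φ(−e_ν) + φ(0))`.
[cite: Balaban1987RG1, (5.36)–(5.37) p.297] -/
theorem hasSum_wilsonQ_mul (μ ν : Fin d) (φ : Pt d → ℂ) :
    HasSum (fun x => wilsonQ μ ν x * φ x)
      ((if μ = ν then ∑ κ : Fin d, (φ 0 - φ (unitVec κ) - φ (-unitVec κ) + φ 0) else 0) -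
        (φ (unitVec μ - unitVec ν) - φ (unitVec μ) - φ (-unitVec ν) + φ 0)) := by
  have hc := hasSum_crossQ_mul μ ν φ
  have hl : HasSum (fun x => (if μ = ν then ∑ κ, crossQ κ κ x else 0 : ℂ) * φ x)
      (if μ = ν then ∑ κ : Fin d, (φ 0 - φ (unitVec κ) - φ (-unitVec κ) + φ 0) else 0) := by
    by_cases h : μ = ν
    · simp only [if_pos h]
      simp_rw [Finset.sum_mul]
      refine hasSum_sum fun κ _ => ?_
      have := hasSum_crossQ_mul κ κ φ
      rwa [sub_self] at this
    · simp only [if_neg h, zero_mul]; exact hasSum_zero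
  have e : (fun x => wilsonQ μ ν x * φ x) = fun x =>
      (if μ = ν then ∑ κ, crossQ κ κ x else 0 : ℂ) * φ x - crossQ μ ν x * φ x := by
    funext x; simp only [wilsonQ, sub_mul]
  rw [e]; exact hl.sub hc

/-- **Zeroth moment**: `Σ_x Q_{μν}(x) = 0` (`Q̃_{μν}(0) = 0`). [cite: Balaban1987RG1, (5.16) p.293 / (5.37) p.297] -/
theorem tsum_wilsonQ (μ ν : Fin d) : ∑' x, wilsonQ μ ν x = 0 := by
  have h := (hasSum_wilsonQ_mul μ ν (fun _ => (1 : ℂ))).tsum_eq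
  simp only [mul_one] at h
  rw [h]; split_ifs <;> simp

/-- **First moments**: `Σ_x Q_{μν}(x)x_κ = 0` (`∂_κQ̃_{μν}(0) = 0`). [cite: Balaban1987RG1, (5.16) p.293 / (5.37) p.297] -/
theorem tsum_wilsonQ_mul_coord (μ ν κ : Fin d) : ∑' x : Pt d, wilsonQ μ ν x * (x κ : ℂ) = 0 := by
  have h := (hasSum_wilsonQ_mul μ ν (fun x => ((x κ : ℤ) : ℂ))).tsum_eq
  rw [h]
  have A : ∀ κ' : Fin d, (((0 : Pt d) κ : ℤ) : ℂ) - (((unitVec κ') κ : ℤ) : ℂ) - (((-unitVec κ') κ : ℤ) : ℂ) +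
      (((0 : Pt d) κ : ℤ) : ℂ) = 0 := by
    intro κ'; simp only [Pi.zero_apply, Pi.neg_apply, Int.cast_zero, Int.cast_neg]; ring
  have B : (((unitVec μ - unitVec ν) κ : ℤ) : ℂ) - (((unitVec μ) κ : ℤ) : ℂ) - (((-unitVec ν) κ : ℤ) : ℂ) +
      (((0 : Pt d) κ : ℤ) : ℂ) = 0 := by
    simp only [Pi.sub_apply, Pi.zero_apply, Pi.neg_apply, Int.cast_zero, Int.cast_neg, Int.cast_sub]; ring
  rw [B, Finset.sum_eq_zero (fun κ' _ => A κ')]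
  split_ifs <;> simp

/-- `Σ_κ' δ_{κκ'}δ_{λκ'} = δ_{λκ}`. [folklore] -/
theorem sum_kron_mul_kron (κ τ : Fin d) : ∑ κ' : Fin d, kron κ κ' * kron τ κ' = kron τ κ := by
  simp only [kron, ite_mul, one_mul, zero_mul]
  rw [Finset.sum_ite_eq]; simp

/-- **Second moments**: `Σ_x Q_{μν}(x)x_κx_λ = −2δ_{μν}δ_{λκ} + δ_{κμ}δ_{λν} + δ_{κν}δ_{λμ}`
(`= −∂_κ∂_λ[δ_{μν}|p|² − p_μp_ν]`: the second-order Taylor data of `δ_{μν}Δ(p) − \overline{∂_μ(p)}∂_ν(p)` at `p = 0` are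
those of the transverse form `δ_{μν}|p|² − p_μp_ν`). [cite: Balaban1987RG1, (5.16) p.293 / (5.37), (5.42) p.297] -/
theorem tsum_wilsonQ_mul_coord2 (μ ν κ τ : Fin d) :
    ∑' x : Pt d, wilsonQ μ ν x * ((x κ : ℂ) * (x τ : ℂ)) =
      -(2 * kron μ ν * kron τ κ) + kron κ μ * kron τ ν + kron κ ν * kron τ μ := by
  have h := (hasSum_wilsonQ_mul μ ν (fun x => ((x κ : ℤ) : ℂ) * ((x τ : ℤ) : ℂ))).tsum_eq
  rw [h]
  simp only [Pi.zero_apply, Pi.neg_apply, Pi.sub_apply, Int.cast_zero, Int.cast_neg, Int.cast_sub,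
    unitVec_cast]
  have A : ∀ κ' : Fin d, (0 : ℂ) * 0 - kron κ κ' * kron τ κ' - -kron κ κ' * -kron τ κ' + 0 * 0 =
      -2 * (kron κ κ' * kron τ κ') := by intro κ'; ring
  rw [Finset.sum_congr rfl (fun κ' _ => A κ'), ← Finset.mul_sum, sum_kron_mul_kron]
  unfold kron; split_ifs <;> ring

/-! ## §5 (5.36) ⇒ (5.37)/(5.38) with (5.44), and (5.42) -/

/-- **"(5.36)/(5.37) up to third-order terms"** — the second-order TAYLOR DATA hypothesis, coefficient side: every
monomial moment of order ≤ 2 of the kernel `Π` equals `β ×` the corresponding moment of the marginal kernel `Q_{μν}`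
(i.e. `Π̃(p) − βQ̃_{μν}(p) = O(|p|³)` at `p = 0`; by `tsum_wilsonQ*`: `Σ_xΠ(x) = 0`, `Σ_xΠ(x)x_κ = 0`,
`Σ_xΠ(x)x_κx_λ = β(−2δ_{μν}δ_{κλ} + δ_{μκ}δ_{νλ} + δ_{μλ}δ_{νκ})`).  This is the OUTPUT of the symmetry analysis
(5.12)–(5.36) (finite algebra certified at jet level in `B12Sec5Algebra`), displayed here as a hypothesis.
[cite: Balaban1987RG1, (5.36)–(5.37) p.297; (5.16) p.293] -/
def TaylorData3 (β : ℂ) (μ ν : Fin d) (P : Pt d → ℂ) : Prop :=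
  ∀ γ : Fin d → ℕ, deg γ < 3 → ∑' x, P x * monom γ x = β * ∑' x, wilsonQ μ ν x * monom γ x

/-- (5.10) + Taylor data ⇒ all binomial moments of order `< 3` of `Π − βQ_{μν}` vanish (the hypothesis of the
periodic Gleason lemma with `k = 3`). [cite: Balaban1987RG1, (5.36)–(5.38) p.297] -/
theorem momentsVanish_sub {a M : ℝ} (ha : 0 < a) {P : Pt d → ℂ} (hP : ExpBound a M P) {β : ℂ} {μ ν : Fin d}
    (hT : TaylorData3 β μ ν P) : MomentsVanish 3 (P - β • wilsonQ μ ν) := by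
  have hQ := wilsonQ_bound ha μ ν
  refine momentsVanish_of_monomial ha (expBound_sub ha hP β μ ν) fun γ hγ => ?_
  have h1 : Summable fun x => P x * monom γ x :=
    hP.summable_mul ha (norm_monom_le γ (fun j => le_deg γ j))
  have h2 : Summable fun x => wilsonQ μ ν x * monom γ x :=
    hQ.summable_mul ha (norm_monom_le γ (fun j => le_deg γ j))
  calc ∑' x, (P - β • wilsonQ μ ν) x * monom γ x
        = ∑' x, (P x * monom γ x - β * (wilsonQ μ ν x * monom γ x)) :=
          tsum_congr fun x => by simp [sub_mul, mul_assoc]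
    _ = ∑' x, P x * monom γ x - β * ∑' x, wilsonQ μ ν x * monom γ x := by
          rw [h1.tsum_sub (h2.mul_left β), tsum_mul_left]
    _ = 0 := by rw [hT γ hγ, sub_self]

/-- `x^γ = x_μ x_ν` for the multi-index `γ = e_μ + e_ν`, `μ ≠ ν`. [folklore] -/
theorem monom_pair {μ ν : Fin d} (x : Pt d) :
    monom (fun j => (if j = μ then 1 else 0) + (if j = ν then 1 else 0)) x = (x μ : ℂ) * (x ν : ℂ) := by
  simp only [monom, pow_add, Finset.prod_mul_distrib]
  have e : ∀ i : Fin d, (∏ j, ((x j : ℤ) : ℂ) ^ (if j = i then 1 else 0)) = (x i : ℂ) := by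
    intro i
    rw [Finset.prod_eq_single i]
    · simp
    · intro j _ hj; simp [hj]
    · simp
  rw [e μ, e ν]

/-- **(5.42) is forced** (by the Taylor data alone): if the second-order Taylor data of `Π` are `β ×` those of
`Q_{μν}` then, for `μ ≠ ν`, `β = Σ_x Π(x)x_μx_ν` ("This is the fundamental equality defining the β-function").
[cite: Balaban1987RG1, (5.42) p.297] -/
theorem beta_eq_542 {P : Pt d → ℂ} {β : ℂ} {μ ν : Fin d}
    (hT : TaylorData3 β μ ν P) (hμν : μ ≠ ν) : β = ∑' x : Pt d, P x * ((x μ : ℂ) * (x ν : ℂ)) := by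
  have hdeg : deg (fun j : Fin d => (if j = μ then 1 else 0) + (if j = ν then 1 else 0)) < 3 := by
    simp only [deg, Finset.sum_add_distrib, Finset.sum_ite_eq', Finset.mem_univ, if_true]
    norm_num
  have h := hT _ hdeg
  simp_rw [monom_pair] at h
  rw [tsum_wilsonQ_mul_coord2] at h
  have hv : -(2 * kron μ ν * kron ν μ) + kron μ μ * kron ν ν + kron μ ν * kron ν μ = (1 : ℂ) := by
    simp [kron, hμν]
  rw [hv, mul_one] at h
  exact h.symm

/-- The remainder coefficient kernels `Π′_{κλρ}` (`(κ,λ,ρ) = μs : Fin 3 → Fin d`) of the representation (5.38): the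
G–K potentials of `Π − βQ_{μν}` (linear in `Π − βQ_{μν}`). [cite: Balaban1987RG1, (5.38) p.297] -/
def rem538 (P : Pt d → ℂ) (β : ℂ) (μ ν : Fin d) (μs : Fin 3 → Fin d) : Pt d → ℂ :=
  potIter 3 (P - β • wilsonQ μ ν) μs

/-- **(5.37) + (5.38) with (5.44), coefficient form.**  If `|Π(x)| ≤ M e^{−a|x|₁}` ((5.10), `a = δ₁`) and the
second-order Taylor data of `Π` are `β ×` those of `Q_{μν}` ((5.36)), then
`Π(x) − β·Q_{μν}(x) = Σ_{(κ,λ,ρ)} (Δ*_κΔ*_λΔ*_ρ Π′_{κλρ})(x)` — a third-order polynomial in the backward differences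
(symbol side: in `\overline{∂_κ(p)}`) — with `|Π′_{κλρ}(x)| ≤ K(a,d)³·(M + |β|·MQ(a,d))·e^{−a|x|₁}`: the remainder
coefficients decay at the SAME rate `a = δ₁` (print: ½δ₁), constant depending on `δ₁`, `d` only times `M + |β|MQ`.
[cite: Balaban1987RG1, (5.37)–(5.38), (5.44) p.297] -/
theorem rep538 {a M : ℝ} (ha : 0 < a) {P : Pt d → ℂ} (hP : ExpBound a M P) {β : ℂ} {μ ν : Fin d}
    (hT : TaylorData3 β μ ν P) :
    (∀ x, P x - β * wilsonQ μ ν x = ∑ μs : Fin 3 → Fin d, deltaIter 3 μs (rem538 P β μ ν μs) x) ∧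
      ∀ μs : Fin 3 → Fin d, ExpBound a (K a d ^ 3 * (M + ‖β‖ * MQ a d)) (rem538 P β μ ν μs) := by
  obtain ⟨h1, h2⟩ := gleason_coeff ha 3 (P - β • wilsonQ μ ν) (expBound_sub ha hP β μ ν)
    (momentsVanish_sub ha hP hT)
  refine ⟨fun x => ?_, h2⟩
  have := h1 x
  simpa [rem538] using this

/-- **(5.37) + (5.38), printed multiplicative form, with the sup bounds behind (5.44).**  On the closed poly-annulus
`e^{−b} ≤ |w_j| ≤ e^{b}`, `b < a = δ₁` (the closed sub-polystrip `|q_j| ≤ b` at `w = e^{−iζ}`):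
`Σ_xΠ(x)wˣ = β(δ_{μν}Σ_κ(w_κ − 1)(w_κ⁻¹ − 1) − (w_μ − 1)(w_ν⁻¹ − 1)) + Σ_{(κ,λ,ρ)}(w_κ − 1)(w_λ − 1)(w_ρ − 1)·Π̃′_{κλρ}(w)`,
i.e. `Π̃_{μν} = β(δ_{μν}Δ − \overline{∂_μ}∂_ν) + Σ \overline{∂_κ}\,\overline{∂_λ}\,\overline{∂_ρ}·Π̃′_{μν,κλρ}`, each
`Π̃′` an absolutely convergent Laurent series bounded by `K(a,d)³(M + |β|MQ(a,d))·Z_d(a − b)` there.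
[cite: Balaban1987RG1, (5.37)–(5.38) p.297 ("The coefficients Π′ can be extended to analytic functions of ζ = p + iq on the polystrip")] -/
theorem rep537_genFun {a M : ℝ} (ha : 0 < a) {P : Pt d → ℂ} (hP : ExpBound a M P) {β : ℂ} {μ ν : Fin d}
    (hT : TaylorData3 β μ ν P) {b : ℝ} (hab : b < a) {z : Fin d → ℂ} (hz : z ∈ PolyAnnulus d b) :
    genFun P z = β * ((if μ = ν then ∑ κ, (z κ - 1) * ((z κ)⁻¹ - 1) else 0) - (z μ - 1) * ((z ν)⁻¹ - 1)) +
        ∑ μs : Fin 3 → Fin d, (∏ j, (z (μs j) - 1)) * genFun (rem538 P β μ ν μs) z ∧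
      ∀ μs : Fin 3 → Fin d, ‖genFun (rem538 P β μ ν μs) z‖ ≤ K a d ^ 3 * (M + ‖β‖ * MQ a d) * Zd (a - b) d := by
  obtain ⟨h1, h2⟩ := gleason_genFun ha (expBound_sub ha hP β μ ν) (momentsVanish_sub ha hP hT) hab hz
  refine ⟨?_, h2⟩
  have hsP := hP.summable_mul_zpowv hab hz
  have hsQ := (wilsonQ_bound ha μ ν).summable_mul_zpowv hab hz
  have hsplit : genFun (P - β • wilsonQ μ ν) z = genFun P z - β * genFun (wilsonQ μ ν) z := by
    unfold genFun
    rw [← tsum_mul_left, ← hsP.tsum_sub (hsQ.mul_left β)]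
    exact tsum_congr fun n => by simp [sub_mul, mul_assoc]
  rw [hsplit, genFun_wilsonQ hz] at h1
  have e : ∀ μs : Fin 3 → Fin d, potIter 3 (P - β • wilsonQ μ ν) μs = rem538 P β μ ν μs := fun _ => rfl
  simp only [e] at h1
  linear_combination h1

/-! ## §6 The cell's typed (5.10) and (1.22): real B12 kernels -/

/-- A real position-space kernel read on the complex carrier. [folklore] -/
def ofReal (P : Pt d → ℝ) : Pt d → ℂ := fun x => (P x : ℂ)

/-- The cell's typed (5.10) `B12Sec2to5.Decay510 Π C δ₁` (`|Π(x)| ≤ C e^{−δ₁|x|₁}`) is `ExpBound δ₁ C`.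
[cite: Balaban1987RG1, (5.10) p.293] -/
theorem expBound_of_decay510 {P : Pt d → ℝ} {C δ₁ : ℝ} (h : B12Sec2to5.Decay510 P C δ₁) :
    ExpBound δ₁ C (ofReal P) := by
  intro x
  have hx := h x
  rw [ofReal, Complex.norm_real, Real.norm_eq_abs]
  exact hx

/-- **(5.42) = (1.22)**: for a real B12 kernel whose `(μ,ν)`-component has second-order Taylor data `β × Q_{μν}`'s,
`μ ≠ ν`, the coefficient `β` IS `B12Beta.secondMoment Π μ ν = Σ_x Π_{μν}(x)x_μx_ν` (the right member of (1.22)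
p. 264; both sides are the same lattice sum, so no decay hypothesis is needed for the identity itself). [cite: Balaban1987RG1, (5.42) p.297; (1.22) p.264] -/
theorem beta_eq_secondMoment {P : B12Beta.Kernel d} {μ ν : Fin d} {β : ℝ}
    (hT : TaylorData3 (β : ℂ) μ ν (ofReal (P μ ν))) (hμν : μ ≠ ν) : β = B12Beta.secondMoment P μ ν := by
  have h := beta_eq_542 hT hμν
  have h2 : (∑' x : Pt d, ofReal (P μ ν) x * ((x μ : ℂ) * (x ν : ℂ))) =
      ((B12Beta.secondMoment P μ ν : ℝ) : ℂ) := by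
    rw [B12Beta.secondMoment, Complex.ofReal_tsum]
    refine tsum_congr fun x => ?_
    simp only [ofReal]; push_cast; ring
  exact_mod_cast h.trans h2

/-- **(5.37)/(5.38) + (5.44) from the cell's (5.10)**: for a real kernel with `B12Sec2to5.Decay510 Π C δ₁`, `δ₁ > 0`,
and second-order Taylor data `β × Q_{μν}`'s: `Π(x) − βQ_{μν}(x) = Σ_{(κ,λ,ρ)}(Δ*_κΔ*_λΔ*_ρ Π′_{κλρ})(x)` with
`|Π′_{κλρ}(x)| ≤ K(δ₁,d)³(C + |β|MQ(δ₁,d))·e^{−δ₁|x|₁}`. [cite: Balaban1987RG1, (5.37)–(5.38), (5.44) p.297; (5.10) p.293] -/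
theorem rep538_of_decay510 {P : Pt d → ℝ} {C δ₁ : ℝ} {β : ℂ} {μ ν : Fin d} (hδ : 0 < δ₁)
    (h510 : B12Sec2to5.Decay510 P C δ₁) (hT : TaylorData3 β μ ν (ofReal P)) :
    (∀ x, (P x : ℂ) - β * wilsonQ μ ν x = ∑ μs : Fin 3 → Fin d, deltaIter 3 μs (rem538 (ofReal P) β μ ν μs) x) ∧
      ∀ (μs : Fin 3 → Fin d) (x : Pt d),
        ‖rem538 (ofReal P) β μ ν μs x‖ ≤ K δ₁ d ^ 3 * (C + ‖β‖ * MQ δ₁ d) * Real.exp (-δ₁ * l1 x) :=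
  rep538 hδ (expBound_of_decay510 h510) hT

end

end Literature.MathematicalPhysics.QuantumFieldTheory.Balaban1983to89.B12Rep537
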